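import Summits.QuantumFields.YangMills.Theorems.SwapVirialDeficitZeroModeGroupFourSmallBallLogPrelim
import HarnessLib

/-!
# Exact zero-mode rung, FOUR pairwise nearly commuting letters — XII-b: the LOG-LIMIT assembly `N₄(t) ~ w₄·t⁶·log(1/t)`
# (zero-mode block of crux ⟨stmt-QuantumFields-24497⟩ `ToronTubeVolumeLaw` in LIMIT form; free-hands support of ⟨stmt-QuantumFields-24197⟩;
# part XII of fcl-p3 g44's programme, following the recipe of HOME `fcl-p3-g44-memo-24197-K4-two-scale-log.md`)

From part XI's two-sided bounds ✓`Irad_le` / ✓`le_Irad` (any `0 < a ≤ δ ≤ 1`, `r₀ > 0`, constants `B^±` bounding the two-scale volume `V_t` on the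
middle region) and the joint continuity ✓`tendsto_volume_twoScale_origin` we assemble:
* (part XII-a `…FourSmallBallLogPrelim`: ε–θ form of the joint limit, real forms of the bounds, the middle regime, parameter choices);
* §42 ★★★ `tendsto_Irad_div_log : I(t)/log(1/t) → h₀/256`, `h₀ = vol³(T(0,0,0))` (order of choices: gap → ε → θ → r₀ → δ → A → t; `tendsto_order`);
* §43 ★★★ `tendsto_haar_nearlyCommuting_div_log : Haar⁴(N₄(t))/(t⁶·log(1/t)) → w₄ = π·coneConst⁴·h₀/64` (✓`haar_nearlyCommuting_eq_Irad`), with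
  `w₄ > 0` — the t⁶·log(1/t) small-ball law of four pairwise nearly commuting SU(2) letters in LIMIT form with its canonical constant.
HONEST LABEL: finite-dimensional measure theory / real analysis on `SU(2)⁴` (plan-level zero-mode rung of DRAFT lines); NOT ⟨24497⟩, NOT ⟨24197⟩;
own crux ⟨22884⟩ OPEN (blocked-on ⟨19935⟩); the Yang–Mills mass gap is NOT proved; no summit is proved by a line.
Width seat ym-line-sfw-p2-w3 g63 (cell ym-idea-1, free hands), `--supports stmt-QuantumFields-24197`.  THEOREMS ONLY, standard axioms, 0 `sorry`.
References: [cite: GonzalezarroyoAltes1988]; [cite: Vanbaal2001]; [cite: Luscher1983, §2]; [folklore].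
-/

set_option autoImplicit false

noncomputable section

open MeasureTheory Quaternion Set Real Filter Topology
open scoped Quaternion ENNReal BigOperators Topology
open Literature.MathematicalPhysics.QuantumLattice
open Summit.QuantumFields.YangMills.Theorems.SwapTwistDeficit.ToronLog

attribute [local instance] Literature.Analysis.FluidPDE.Tao2016.quatMeasurableSpace
  Literature.Analysis.FluidPDE.Tao2016.quatBorelSpace
  Literature.MathematicalPhysics.QuantumLattice.secondCountableTopology_su2

namespace Summit.QuantumFields.YangMills.Theorems.SwapVirialDeficit.ZeroModeGroup

/-! ## §42 (continued) The limit `I(t)/log(1/t) → h₀/256` -/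

/-- ★★ Upper half: for `b > h₀/256`, eventually `I(t)/log(1/t) < b`. [folklore] -/
theorem eventually_Irad_div_log_lt {b : ℝ}
    (hb : ((((volume : Measure ℍ).prod (volume : Measure ℍ)).prod (volume : Measure ℍ)) (twoScaleSet4 0 0 0)).toReal / 256 < b) :
    ∀ᶠ t in 𝓝[>] (0:ℝ), (Irad t).toReal / Real.log (1 / t) < b := by
  obtain ⟨h0, hh0⟩ : ∃ x : ℝ, x = ((((volume : Measure ℍ).prod (volume : Measure ℍ)).prod (volume : Measure ℍ)) (twoScaleSet4 0 0 0)).toReal :=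
    ⟨_, rfl⟩
  obtain ⟨Dr, hDr⟩ : ∃ x : ℝ, x = ((((volume : Measure ℍ).prod (volume : Measure ℍ)).prod (volume : Measure ℍ)) domSet4).toReal := ⟨_, rfl⟩
  obtain ⟨Cr, hCr⟩ : ∃ x : ℝ, x = decayConst.toReal := ⟨_, rfl⟩
  rw [← hh0] at hb
  have h0nn : 0 ≤ h0 := by rw [hh0]; exact ENNReal.toReal_nonneg
  have hDr0 : 0 ≤ Dr := by rw [hDr]; exact ENNReal.toReal_nonneg
  have hCr0 : 0 ≤ Cr := by rw [hCr]; exact ENNReal.toReal_nonneg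
  -- the gap and the choices `ε → θ → (r₀, δ) → A`
  obtain ⟨gap, hgapdef⟩ : ∃ gap : ℝ, gap = b - h0 / 256 := ⟨_, rfl⟩
  have hgap0 : 0 < gap := by rw [hgapdef]; linarith
  have hε : 0 < 64 * gap := by positivity
  obtain ⟨θ, hθ, hθV⟩ := exists_theta (ofReal_ne_zero_of_pos hε)
  obtain ⟨r₀, δ, hr₀, hδ, hδh, hδθ, hr₀g, hδg⟩ := upper_params (ε := 64 * gap) h0nn hDr0 hgap0 hε hθ
  have hδ1 : δ ≤ 1 := by linarith
  obtain ⟨A, hAdef⟩ : ∃ A : ℝ, A = max 1 (1 / θ) := ⟨_, rfl⟩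
  have hA1 : 1 ≤ A := by rw [hAdef]; exact le_max_left _ _
  have hAθ : 1 / θ ≤ A := by rw [hAdef]; exact le_max_right _ _
  have hA0 : 0 < A := by linarith
  -- the `t`-independent constant `K₀` and the slope `M`
  obtain ⟨K₀, hK₀⟩ : ∃ K₀ : ℝ, K₀ = 2 * (A * (Real.sqrt 2 / 64)) * Cr + 2 * (1 / (64 * δ)) * Dr := ⟨_, rfl⟩
  have hK₀0 : 0 ≤ K₀ := by rw [hK₀]; positivity
  obtain ⟨M, hM⟩ : ∃ M : ℝ, M = 8 * r₀ * Dr + (1 / 2 + 6 * δ) * (h0 + 64 * gap) := ⟨_, rfl⟩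
  have hM0 : 0 ≤ M := by rw [hM]; positivity
  have hU : M / 128 ≤ b - gap / 2 := by
    rw [hM]
    have e : b = h0 / 256 + gap := by linarith
    rw [e]
    nlinarith [hr₀g, hδg]
  -- thresholds for `t`
  have ht₁0 : 0 < min (min (1/2 : ℝ) ((δ / A) ^ 2)) (min (4 * A ^ 2 * θ) (Real.exp (-(2 * K₀ / gap + 1)))) :=
    lt_min (lt_min (by norm_num) (by positivity)) (lt_min (by positivity) (Real.exp_pos _))
  filter_upwards [eventually_pos_lt ht₁0] with t ht
  obtain ⟨ht0, htt⟩ := ht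
  have ht1 : t < 1/2 := lt_of_lt_of_le htt ((min_le_left _ _).trans (min_le_left _ _))
  have ht2 : t < (δ / A) ^ 2 := lt_of_lt_of_le htt ((min_le_left _ _).trans (min_le_right _ _))
  have ht3 : t < 4 * A ^ 2 * θ := lt_of_lt_of_le htt ((min_le_right _ _).trans (min_le_left _ _))
  have ht4 : t < Real.exp (-(2 * K₀ / gap + 1)) := lt_of_lt_of_le htt ((min_le_right _ _).trans (min_le_right _ _))
  have hI := Irad_toReal_le_middle ht0 hθ hA1 hAθ hr₀ hδ hδ1 hδθ ht3.le ht2.le hε hθV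
  rw [← hh0, ← hDr, ← hCr] at hI
  have hℓ : 0 < Real.log (1 / t) := Real.log_pos (by rw [lt_div_iff₀ ht0]; linarith)
  have hlog : Real.log (δ / (A * Real.sqrt t)) ≤ Real.log (1 / t) / 2 := by
    rw [log_div_mul_sqrt hA0 hδ ht0]
    have h1 : Real.log (δ / A) ≤ 0 := Real.log_nonpos (by positivity) (by rw [div_le_one hA0]; linarith)
    linarith
  have hI' : (Irad t).toReal ≤ K₀ + Real.log (δ / (A * Real.sqrt t)) / 64 * M := by rw [hK₀, hM]; linarith [hI]
  have hℓK : K₀ < gap / 2 * Real.log (1 / t) := by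
    have h1 : 2 * K₀ / gap + 1 < Real.log (1 / t) := by
      rw [one_div, Real.log_inv]
      have h := Real.log_lt_log ht0 ht4
      rw [Real.log_exp] at h; linarith
    have h := mul_lt_mul_of_pos_left h1 (by positivity : 0 < gap / 2)
    have h2 : gap / 2 * (2 * K₀ / gap + 1) = K₀ + gap / 2 := by field_simp
    rw [h2] at h; linarith
  exact div_lt_of_affine_bound hℓ hM0 hlog hI' hU hℓK

/-- ★★ Lower half: for `b < h₀/256`, eventually `b < I(t)/log(1/t)`. [folklore] -/
theorem eventually_lt_Irad_div_log {b : ℝ}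
    (hb : b < ((((volume : Measure ℍ).prod (volume : Measure ℍ)).prod (volume : Measure ℍ)) (twoScaleSet4 0 0 0)).toReal / 256) :
    ∀ᶠ t in 𝓝[>] (0:ℝ), b < (Irad t).toReal / Real.log (1 / t) := by
  obtain ⟨h0, hh0⟩ : ∃ x : ℝ, x = ((((volume : Measure ℍ).prod (volume : Measure ℍ)).prod (volume : Measure ℍ)) (twoScaleSet4 0 0 0)).toReal :=
    ⟨_, rfl⟩
  rw [← hh0] at hb
  have h0pos : 0 < h0 := by
    rw [hh0]; exact ENNReal.toReal_pos (volume_twoScale_limit_pos le_rfl).ne' (volume_twoScaleSet4_lt_top le_rfl le_rfl le_rfl).ne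
  by_cases hb0 : b < 0
  · filter_upwards [eventually_pos_lt (by norm_num : (0:ℝ) < 1/2)] with t ht
    have hℓ : 0 ≤ Real.log (1 / t) := Real.log_nonneg (by rw [le_div_iff₀ ht.1]; linarith [ht.2])
    exact lt_of_lt_of_le hb0 (div_nonneg ENNReal.toReal_nonneg hℓ)
  rw [not_lt] at hb0
  -- the gap and the choices `ε → θ → (r₀, δ) → A`
  obtain ⟨gap, hgapdef⟩ : ∃ gap : ℝ, gap = h0 / 256 - b := ⟨_, rfl⟩
  have hgap0 : 0 < gap := by rw [hgapdef]; linarith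
  obtain ⟨ε, hεdef⟩ : ∃ ε : ℝ, ε = min (h0 / 2) (64 * gap) := ⟨_, rfl⟩
  have hε : 0 < ε := by rw [hεdef]; exact lt_min (by positivity) (by positivity)
  have hεh : ε ≤ h0 / 2 := by rw [hεdef]; exact min_le_left _ _
  have hεg : ε ≤ 64 * gap := by rw [hεdef]; exact min_le_right _ _
  obtain ⟨θ, hθ, hθV⟩ := exists_theta (ofReal_ne_zero_of_pos hε)
  obtain ⟨r₀, δ, hr₀, hr₀h, hδ, hδh, hδθ, hr₀g, hδg⟩ := lower_params h0pos.le hgap0 hθ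
  have hrδ : r₀ ^ 2 + δ ^ 2 < 1 := by nlinarith
  obtain ⟨A, hAdef⟩ : ∃ A : ℝ, A = max 1 (1 / θ) := ⟨_, rfl⟩
  have hA1 : 1 ≤ A := by rw [hAdef]; exact le_max_left _ _
  have hAθ : 1 / θ ≤ A := by rw [hAdef]; exact le_max_right _ _
  have hA0 : 0 < A := by linarith
  -- the slope `P` and its size
  obtain ⟨P, hPdef⟩ : ∃ P : ℝ, P = ((1 - δ ^ 2) ^ 2 - r₀ ^ 4) / 2 * (h0 - ε) := ⟨_, rfl⟩
  have hq : 1 - 2 * δ - r₀ ≤ (1 - δ ^ 2) ^ 2 - r₀ ^ 4 := by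
    have h1 : δ ^ 2 ≤ δ := by nlinarith
    have h2 : r₀ ^ 4 ≤ r₀ := by
      have h3 : r₀ ^ 3 ≤ 1 := pow_le_one₀ hr₀.le (by linarith)
      nlinarith [pow_pos hr₀ 3]
    nlinarith [sq_nonneg (δ ^ 2)]
  have hqq : 0 ≤ (1 - δ ^ 2) ^ 2 - r₀ ^ 4 := by
    have h1 : 0 < 1 - δ ^ 2 - r₀ ^ 2 := by linarith
    have h2 : 0 < 1 - δ ^ 2 + r₀ ^ 2 := by nlinarith
    nlinarith [mul_pos h1 h2]
  have hP0 : 0 ≤ P := by rw [hPdef]; exact mul_nonneg (by positivity) (by linarith)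
  have hPb : b + gap / 2 ≤ P / 128 := by
    have h1 : (1 - 2 * δ - r₀) * (h0 - ε) ≤ ((1 - δ ^ 2) ^ 2 - r₀ ^ 4) * (h0 - ε) := mul_le_mul_of_nonneg_right hq (by linarith)
    have e : b = h0 / 256 - gap := by linarith
    rw [hPdef, e]
    nlinarith [hδg, hr₀g, hεg, mul_nonneg hδ.le hε.le, mul_nonneg hr₀.le hε.le]
  obtain ⟨Q, hQdef⟩ : ∃ Q : ℝ, Q = |Real.log (δ / A)| * P / (32 * gap) := ⟨_, rfl⟩
  have hQ0 : 0 ≤ Q := by rw [hQdef]; positivity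
  -- thresholds for `t`
  have ht₁0 : 0 < min (min (1/2 : ℝ) ((δ / A) ^ 2)) (min (4 * A ^ 2 * θ) (Real.exp (-(Q + 1)))) :=
    lt_min (lt_min (by norm_num) (by positivity)) (lt_min (by positivity) (Real.exp_pos _))
  filter_upwards [eventually_pos_lt ht₁0] with t ht
  obtain ⟨ht0, htt⟩ := ht
  have ht1 : t < 1/2 := lt_of_lt_of_le htt ((min_le_left _ _).trans (min_le_left _ _))
  have ht2 : t < (δ / A) ^ 2 := lt_of_lt_of_le htt ((min_le_left _ _).trans (min_le_right _ _))
  have ht3 : t < 4 * A ^ 2 * θ := lt_of_lt_of_le htt ((min_le_right _ _).trans (min_le_left _ _))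
  have ht4 : t < Real.exp (-(Q + 1)) := lt_of_lt_of_le htt ((min_le_right _ _).trans (min_le_right _ _))
  have hI := le_Irad_toReal_middle ht0 hθ hA1 hAθ hr₀ hδ hrδ hδθ ht3.le ht2.le hε (by rw [← hh0]; linarith) hθV
  rw [← hh0, log_div_mul_sqrt hA0 hδ ht0, ← hPdef] at hI
  have hℓ : 0 < Real.log (1 / t) := Real.log_pos (by rw [lt_div_iff₀ ht0]; linarith)
  have hℓQ : Q < Real.log (1 / t) := by
    rw [one_div, Real.log_inv]
    have h := Real.log_lt_log ht0 ht4
    rw [Real.log_exp] at h; linarith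
  have hQ' : |Real.log (δ / A)| * P / 64 < gap / 2 * Real.log (1 / t) := by
    have h := mul_lt_mul_of_pos_left hℓQ (by positivity : 0 < 32 * gap)
    have e : 32 * gap * Q = |Real.log (δ / A)| * P := by rw [hQdef]; field_simp
    rw [e] at h; linarith
  exact lt_div_of_affine_bound hℓ hP0 hI hPb hQ'

/-- ★★★ **`I(t)/log(1/t) → h₀/256`** with `h₀ = vol³(T(0,0,0))` (the radial two-scale integral of part XI carries exactly one logarithm,
with coefficient `h₀·∫|a₀|³/128 = h₀/256`). [folklore] -/
theorem tendsto_Irad_div_log :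
    Tendsto (fun t => (Irad t).toReal / Real.log (1 / t)) (𝓝[>] 0)
      (𝓝 (((((volume : Measure ℍ).prod (volume : Measure ℍ)).prod (volume : Measure ℍ)) (twoScaleSet4 0 0 0)).toReal / 256)) := by
  rw [tendsto_order]
  exact ⟨fun b hb => eventually_lt_Irad_div_log hb, fun b hb => eventually_Irad_div_log_lt hb⟩

/-! ## §43 The headline: `Haar⁴(N₄(t))/(t⁶·log(1/t)) → w₄ = π·coneConst⁴·h₀/64 > 0` -/

/-- ★★★ **THE `t⁶·log(1/t)` LAW OF FOUR PAIRWISE NEARLY COMMUTING LETTERS, LIMIT FORM WITH ITS CONSTANT**: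
`Haar⁴{C : Fin 4 → SU(2) | ∀ μ ν, ‖[C μ, C ν]‖ ≤ t} / (t⁶·log(1/t)) → w₄ := π·coneConst⁴·h₀/64` as `t → 0⁺`, `h₀ = vol³(T(0,0,0))`
(parts I–XI of fcl-p3 g44 + §42). [folklore] -/
theorem tendsto_haar_nearlyCommuting_div_log :
    Tendsto (fun t => ((Measure.pi fun _ : Fin 4 =>
        Literature.MathematicalPhysics.QuantumFieldTheory.haarProbability (Matrix.specialUnitaryGroup (Fin 2) ℂ)) (nearlyCommuting t)).toReal /
          (t ^ 6 * Real.log (1 / t))) (𝓝[>] 0)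
      (𝓝 (Real.pi * coneConst ^ 4 * ((((volume : Measure ℍ).prod (volume : Measure ℍ)).prod (volume : Measure ℍ)) (twoScaleSet4 0 0 0)).toReal / 64)) := by
  have hc : 0 ≤ coneConst := coneConst_pos.le
  have h := (tendsto_Irad_div_log).const_mul (4 * Real.pi * coneConst ^ 4)
  have e : ∀ᶠ t in 𝓝[>] (0:ℝ), 4 * Real.pi * coneConst ^ 4 * ((Irad t).toReal / Real.log (1 / t)) =
      ((Measure.pi fun _ : Fin 4 => Literature.MathematicalPhysics.QuantumFieldTheory.haarProbability (Matrix.specialUnitaryGroup (Fin 2) ℂ))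
        (nearlyCommuting t)).toReal / (t ^ 6 * Real.log (1 / t)) := by
    filter_upwards [eventually_pos_lt (by norm_num : (0:ℝ) < 1/2)] with t ht
    have ht0 := ht.1
    have hℓ : 0 < Real.log (1 / t) := Real.log_pos (by rw [lt_div_iff₀ ht0]; linarith [ht.2])
    rw [haar_nearlyCommuting_eq_Irad ht0]
    simp only [ENNReal.toReal_mul, ENNReal.toReal_ofReal (pow_pos ht0 6).le, ENNReal.toReal_ofReal hc, ENNReal.toReal_ofReal (by positivity : (0:ℝ) ≤ 4 * Real.pi)]
    field_simp
  rw [tendsto_congr' e] at h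
  convert h using 2
  ring

/-- ★ **The constant is positive**: `w₄ = π·coneConst⁴·h₀/64 > 0` (`h₀ > 0` by ✓`volume_twoScale_limit_pos`, `coneConst > 0`). [folklore] -/
theorem w4_pos : 0 < Real.pi * coneConst ^ 4 * ((((volume : Measure ℍ).prod (volume : Measure ℍ)).prod (volume : Measure ℍ)) (twoScaleSet4 0 0 0)).toReal / 64 := by
  have h0pos : 0 < ((((volume : Measure ℍ).prod (volume : Measure ℍ)).prod (volume : Measure ℍ)) (twoScaleSet4 0 0 0)).toReal :=
    ENNReal.toReal_pos (volume_twoScale_limit_pos le_rfl).ne' (volume_twoScaleSet4_lt_top le_rfl le_rfl le_rfl).ne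
  have hc := coneConst_pos
  positivity


/-- ★★ **Two-sided eventual form**: for every `ε > 0`, for all small `t > 0`,
`(w₄ − ε)·t⁶·log(1/t) ≤ Haar⁴(N₄(t)) ≤ (w₄ + ε)·t⁶·log(1/t)` — `N₄(t) = w₄·t⁶·log(1/t)·(1 + o(1))`. [folklore] -/
theorem haar_nearlyCommuting_two_sided_log {ε : ℝ} (hε : 0 < ε) :
    ∀ᶠ t in 𝓝[>] (0:ℝ),
      (Real.pi * coneConst ^ 4 * ((((volume : Measure ℍ).prod (volume : Measure ℍ)).prod (volume : Measure ℍ)) (twoScaleSet4 0 0 0)).toReal / 64 - ε) *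
          (t ^ 6 * Real.log (1 / t)) ≤
        ((Measure.pi fun _ : Fin 4 =>
          Literature.MathematicalPhysics.QuantumFieldTheory.haarProbability (Matrix.specialUnitaryGroup (Fin 2) ℂ)) (nearlyCommuting t)).toReal ∧
      ((Measure.pi fun _ : Fin 4 =>
          Literature.MathematicalPhysics.QuantumFieldTheory.haarProbability (Matrix.specialUnitaryGroup (Fin 2) ℂ)) (nearlyCommuting t)).toReal ≤
        (Real.pi * coneConst ^ 4 * ((((volume : Measure ℍ).prod (volume : Measure ℍ)).prod (volume : Measure ℍ)) (twoScaleSet4 0 0 0)).toReal / 64 + ε) *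
          (t ^ 6 * Real.log (1 / t)) := by
  have h := tendsto_haar_nearlyCommuting_div_log
  rw [tendsto_order] at h
  have h1 := h.1 _ (sub_lt_self _ hε)
  have h2 := h.2 _ (lt_add_of_pos_right _ hε)
  filter_upwards [h1, h2, eventually_pos_lt (by norm_num : (0:ℝ) < 1/2)] with t ht1 ht2 ht
  have hℓ : 0 < Real.log (1 / t) := Real.log_pos (by rw [lt_div_iff₀ ht.1]; linarith [ht.2])
  have hD : 0 < t ^ 6 * Real.log (1 / t) := mul_pos (pow_pos ht.1 6) hℓ
  rw [div_lt_iff₀ hD] at ht2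
  rw [lt_div_iff₀ hD] at ht1
  exact ⟨ht1.le, ht2.le⟩


/-- ★★ **Asymptotic-equivalence form**: `Haar⁴(N₄(t)) ~ w₄·t⁶·log(1/t)` as `t → 0⁺` (`Asymptotics.IsEquivalent`). [folklore] -/
theorem haar_nearlyCommuting_isEquivalent_log :
    Asymptotics.IsEquivalent (𝓝[>] (0:ℝ))
      (fun t => ((Measure.pi fun _ : Fin 4 =>
        Literature.MathematicalPhysics.QuantumFieldTheory.haarProbability (Matrix.specialUnitaryGroup (Fin 2) ℂ)) (nearlyCommuting t)).toReal)
      (fun t => Real.pi * coneConst ^ 4 * ((((volume : Measure ℍ).prod (volume : Measure ℍ)).prod (volume : Measure ℍ)) (twoScaleSet4 0 0 0)).toReal / 64 *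
        (t ^ 6 * Real.log (1 / t))) := by
  have hw := w4_pos
  refine Asymptotics.isEquivalent_of_tendsto_one ?_
  have h := (tendsto_haar_nearlyCommuting_div_log).div_const
    (Real.pi * coneConst ^ 4 * ((((volume : Measure ℍ).prod (volume : Measure ℍ)).prod (volume : Measure ℍ)) (twoScaleSet4 0 0 0)).toReal / 64)
  rw [div_self hw.ne'] at h
  refine h.congr' (Filter.Eventually.of_forall fun t => ?_)
  simp only [Pi.div_apply]
  ring


/-! ## §44 The constants made explicit: `coneConst = 2/π²`, `w₄ = h₀/(4π⁷)` -/

/-- ★ **`coneConst = 2/π²`** (the unit ball of `ℍ ≅ ℝ⁴` has volume `π²/2`, ✓`volume_ball_quat`). [folklore] -/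
theorem coneConst_eq_two_div_pi_sq : coneConst = 2 / Real.pi ^ 2 := by
  have hπ : 0 < Real.pi ^ 2 / 2 := by positivity
  rw [show coneConst = (((volume : Measure ℍ) (Metric.ball 0 1))⁻¹).toReal from rfl, Literature.MathematicalPhysics.QuantumLattice.volume_ball_quat,
    ENNReal.toReal_inv, ENNReal.toReal_ofReal hπ.le, inv_div]

/-- ★★★ **The `t⁶·log(1/t)` law with a closed-form prefactor**: `Haar⁴(N₄(t))/(t⁶·log(1/t)) → h₀/(4π⁷)`, `h₀ = vol³(T(0,0,0))`. [folklore] -/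
theorem tendsto_haar_nearlyCommuting_div_log_explicit :
    Tendsto (fun t => ((Measure.pi fun _ : Fin 4 =>
        Literature.MathematicalPhysics.QuantumFieldTheory.haarProbability (Matrix.specialUnitaryGroup (Fin 2) ℂ)) (nearlyCommuting t)).toReal /
          (t ^ 6 * Real.log (1 / t))) (𝓝[>] 0)
      (𝓝 (((((volume : Measure ℍ).prod (volume : Measure ℍ)).prod (volume : Measure ℍ)) (twoScaleSet4 0 0 0)).toReal / (4 * Real.pi ^ 7))) := by
  convert tendsto_haar_nearlyCommuting_div_log using 2
  rw [coneConst_eq_two_div_pi_sq]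
  have hπ : Real.pi ≠ 0 := Real.pi_pos.ne'
  field_simp
  ring


/-- ★★★ **Existential packaging** (the shape LEAD g93 asked for zero-mode rungs): `∃ w > 0, Haar⁴(N₄(t))/(t⁶·log(1/t)) → w`. [folklore] -/
theorem exists_haar_nearlyCommuting_log_law :
    ∃ w : ℝ, 0 < w ∧ Tendsto (fun t => ((Measure.pi fun _ : Fin 4 =>
        Literature.MathematicalPhysics.QuantumFieldTheory.haarProbability (Matrix.specialUnitaryGroup (Fin 2) ℂ)) (nearlyCommuting t)).toReal /
          (t ^ 6 * Real.log (1 / t))) (𝓝[>] 0) (𝓝 w) :=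
  ⟨_, w4_pos, tendsto_haar_nearlyCommuting_div_log⟩


/-! ## §45 A first numeric window for `h₀` and `w₄` -/

/-- `vol(limitBox 0) = 1/64` (the box `(1/2,1) × (−1,1) × (−1/16,1/16)²` of ✓`limitBox`). [folklore] -/
theorem volume_limitBox_zero : (volume : Measure ℍ) (limitBox 0) = ENNReal.ofReal (1 / 64) := by
  have e : limitBox 0 = coord4 ⁻¹' (Ioo (1 / 2 : ℝ) 1 ×ˢ (Ioo (-1 : ℝ) 1 ×ˢ (Ioo (-(1 / (16 * (1 + 0)))) (1 / (16 * (1 + 0))) ×ˢ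
      Ioo (-(1 / (16 * (1 + 0)))) (1 / (16 * (1 + 0)))))) := by
    ext x
    simp only [limitBox, coord4, Set.mem_preimage, Set.mem_prod, Set.mem_Ioo, Set.mem_setOf_eq]
    tauto
  rw [e, measurePreserving_coord4.measure_preimage
    ((measurableSet_Ioo.prod (measurableSet_Ioo.prod (measurableSet_Ioo.prod measurableSet_Ioo))).nullMeasurableSet),
    Measure.volume_eq_prod, Measure.prod_prod, Measure.volume_eq_prod, Measure.prod_prod, Measure.volume_eq_prod, Measure.prod_prod,
    Real.volume_Ioo, Real.volume_Ioo, Real.volume_Ioo, ← ENNReal.ofReal_mul (by norm_num), ← ENNReal.ofReal_mul (by norm_num),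
    ← ENNReal.ofReal_mul (by norm_num)]
  norm_num

/-- ★ **Numeric window for `h₀ = vol³(T(0,0,0))`**: `(1/64)³ ≤ h₀ ≤ 3·(2·(512 + 1024π)·4)` (lower: the product box of ✓`limitBox_prod_subset`;
upper: the majorant ✓`domSet4` ⊆ three copies of ✓`domRef`, each of volume `≤ ∫𝟙_{okRef}Gb² ≤ 2(512+1024π)·4`). [folklore] -/
theorem h0_window :
    (1 / 64 : ℝ) ^ 3 ≤ ((((volume : Measure ℍ).prod (volume : Measure ℍ)).prod (volume : Measure ℍ)) (twoScaleSet4 0 0 0)).toReal ∧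
    ((((volume : Measure ℍ).prod (volume : Measure ℍ)).prod (volume : Measure ℍ)) (twoScaleSet4 0 0 0)).toReal ≤ 3 * (2 * ((512 + 1024 * Real.pi) * 4)) := by
  set V := ((volume : Measure ℍ).prod (volume : Measure ℍ)).prod (volume : Measure ℍ) with hV
  have hfin : V (twoScaleSet4 0 0 0) ≠ ⊤ := (volume_twoScaleSet4_lt_top le_rfl le_rfl le_rfl).ne
  constructor
  · -- lower bound
    have hsub := limitBox_prod_subset (le_refl (0:ℝ))
    have hbox : V ((limitBox 0 ×ˢ limitBox 0) ×ˢ limitBox 0) = ENNReal.ofReal ((1 / 64 : ℝ) ^ 3) := by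
      rw [hV, Measure.prod_prod, Measure.prod_prod, volume_limitBox_zero, ← ENNReal.ofReal_mul (by norm_num), ← ENNReal.ofReal_mul (by norm_num)]
      norm_num
    have h := measure_mono (μ := V) hsub
    rw [hbox] at h
    exact (ENNReal.ofReal_le_iff_le_toReal hfin).1 h
  · -- upper bound
    have hR : V domRef ≤ ENNReal.ofReal 2 * (ENNReal.ofReal (512 + 1024 * Real.pi) * ENNReal.ofReal 4) :=
      volume_domRef_le_lintegral.trans lintegral_indicator_Gb_sq_le
    have h1 : V (twoScaleSet4 0 0 0) ≤ V domRef + V domRef + V domRef :=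
      (volume_twoScaleSet4_le_domSet4 le_rfl le_rfl le_rfl).trans volume_domSet4_le
    have h2 : V (twoScaleSet4 0 0 0) ≤ ENNReal.ofReal (3 * (2 * ((512 + 1024 * Real.pi) * 4))) := by
      refine h1.trans ?_
      rw [show (3 : ℝ) * (2 * ((512 + 1024 * Real.pi) * 4)) = (2 * ((512 + 1024 * Real.pi) * 4)) + (2 * ((512 + 1024 * Real.pi) * 4)) +
        (2 * ((512 + 1024 * Real.pi) * 4)) by ring, ENNReal.ofReal_add (by positivity) (by positivity), ENNReal.ofReal_add (by positivity) (by positivity),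
        ENNReal.ofReal_mul (by norm_num), ENNReal.ofReal_mul (by positivity)]
      exact add_le_add (add_le_add hR hR) hR
    exact ENNReal.toReal_le_of_le_ofReal (by positivity) h2

/-- ★ **Numeric window for the log coefficient**: `(1/64)³/(4π⁷) ≤ w₄ ≤ 3·(2·(512+1024π)·4)/(4π⁷)` (about `3·10⁻¹⁰ ≤ w₄ ≤ 7.5`; not optimised). [folklore] -/
theorem w4_window :
    (1 / 64 : ℝ) ^ 3 / (4 * Real.pi ^ 7) ≤
        ((((volume : Measure ℍ).prod (volume : Measure ℍ)).prod (volume : Measure ℍ)) (twoScaleSet4 0 0 0)).toReal / (4 * Real.pi ^ 7) ∧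
      ((((volume : Measure ℍ).prod (volume : Measure ℍ)).prod (volume : Measure ℍ)) (twoScaleSet4 0 0 0)).toReal / (4 * Real.pi ^ 7) ≤
        3 * (2 * ((512 + 1024 * Real.pi) * 4)) / (4 * Real.pi ^ 7) := by
  obtain ⟨h1, h2⟩ := h0_window
  have hπ : 0 < 4 * Real.pi ^ 7 := by positivity
  exact ⟨div_le_div_of_nonneg_right h1 hπ.le, div_le_div_of_nonneg_right h2 hπ.le⟩

end Summit.QuantumFields.YangMills.Theorems.SwapVirialDeficit.ZeroModeGroup

end
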